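import Summits.BirchSwinnertonDyer.Rank1Residual.X12.O11.StrictSelmerIndexModTorsion
import Summits.BirchSwinnertonDyer.Rank1Residual.Additive.KatoDescentStrictSelmerLevel
import Literature.NumberTheory.EllipticCurves.StrictSelmerRankOne
import HarnessLib

/-!
# HT-C2: the EXACT `p`-strict Selmer count in rank one — `#(Sel_{p^∞}(W/ℚ) ∩ ker res_p) = #Ш(W)[p^∞] · p^{v_p λ(P₁)}`
# (cell `bsd-2adic`, seat `bsd-2adic-tower-1` GEN 59; hand h4 of LEAD ss-1 GEN 20 `HAND-TARGETS-CDC.md` §2,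
# `--supports stmt-BirchSwinnertonDyer-19097 --as helper`; theorems only: no definition, no named fact,
# no instance, no `sorry`)

HONEST FRAMING. One theorem, `HTC2_natCard_strictSelmer_eq`, whose TYPE is the LEAD's lean-checked hand
`HOME/ss/gen20/HANDTARGETS_CDC_GEN20.lean` :69 verbatim: for an elliptic curve `W/ℚ` of Mordell–Weil rank one
and a prime `p`, a NORMALISED functional `λ : W(ℚ_p) →+ ℤ_p` (surjective, kernel = the torsion) and a
generator `P₁` of `W(ℚ)` modulo torsion,
  `Nat.card (Sel_{p^∞}(W/ℚ) ⊓ ker (H¹(ℚ, W[p^∞]) → H¹(ℚ_p, W(ℚ̄_p)[p^∞]))) = Nat.card Ш(W/ℚ)[p^∞] · p ^ v_p(λ(P₁))`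
(tree currency `W.selmerGroupPInfty p ⊓ selmerLocalKerPrimaryTorsion W ℚ_[p] p`). It is the STRICT factor
(§1 step 6) of the LEAD's road to CDC = `OddBlindPackage.FlatBlindControlCardAtTwo` (slot 5 of the registered
line `Cruxes/SupersingularRankZeroAtTwo/Lines/odd_blind_package.lean`, crux stmt-BirchSwinnertonDyer-19097), used
there with `W := W₂`, `p := 2`; it is a theorem about ANY `E/ℚ` of rank one and ANY prime, the sharp form of
`finite_strictSelmer_of_mordellWeilRank_eq_one` (`StrictSelmerRankOne`) and of tower-1 GEN 58's
`FlatBlindTwistSide.exists_natCard_selmerGroup_inf_ker_res_le`. Nothing here closes a stub or an item;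
crux 19097 stays OPEN; BSD is proved for no curve; typed ≠ proved.

PROOF = ASSEMBLY of three kernel theorems of the tree (Greenberg's snake `Sel_str ↠ Ш[p^∞]` with kernel the
strict Kummer classes `{κ_ñ(a·P₁)} ≅ ℤ/p^ñ`, LNM 1716 §2 pp. 62–63):
* `X12.O11.card_strictSelmer_eq_pow_mul_card_sha_modTorsion` (`Rank1Residual/X12/O11/StrictSelmerIndexModTorsion.lean`):
  over any number field `K` and perfect `K`-field `E` with `λ : E(E) → ℤ_p` (kernel = torsion, `p^b ℤ_p ⊆ im λ`)
  and the transport `Sel_{p^∞} ≤` (local Kummer condition at `E`):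
  `#(Sel_{p^∞} ⊓ strict@E) = p^ñ · #Ш[p^∞]`, `ñ` = the exact level of `loc P₁` MODULO TORSION;
* `StrictCount.modTorsion_level_of_surjective` (`Rank1Residual/Additive/KatoDescentStrictSelmerLevel.lean`): for a
  SURJECTIVE `λ` with kernel the torsion the mod-torsion level of `X` is `v(λ X)` — the hand's exponent;
* `StrictSha.selmerGroupPInfty_le_selmerLocalKerPrimary_padic` (`Rank1Residual/Additive/StrictSelmerDominatesSha.lean`):
  the Selmer local condition at `p`, imposed in the tree at `v.adicCompletion ℚ` (`v ∣ p`), transported to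
  Mathlib's `ℚ_[p]` along `Padic.adicCompletionEquiv`.
Glue: `P₁` has infinite order (`rank = 1`: `exists_generator_of_mordellWeilRank_eq_one` + `hgen`), hence
`λ(P₁) ≠ 0` in `W(ℚ_p)` (base change of points is injective); `hsurj` gives `im λ ⊇ p^0 ℤ_p`; the general
theorems are elaborated with the classical `DecidableEq` on the base field while over `ℚ` Lean finds
`instDecidableEqRat` — `convert` bridges the (subsingleton) instance gap, as in
`X12.O11.StrictSelmerIndexModTorsionRat`. The binder `[Finite Ш[p^∞]]` of the hand is idle for the
equality (both sides are `Nat.card`) and is only referenced.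

References: [GreenbergLNM1716] R. Greenberg, LNM 1716 (1999), §2 pp. 62–63; [KuriharaPollack2007] §1.5
(p. 361); [SilvermanAEC2009] Prop. VII.6.3, Thm. VIII.6.7; [Skinner2020] Ann. of Math. 191, §2.2
(Lemma `rank1lemma`).
-/

set_option autoImplicit false
set_option linter.dupNamespace false

noncomputable section

open scoped Classical NumberField AddSubgroup

namespace Summit.BirchSwinnertonDyer.BirchSwinnertonDyer.Theorems.FlatBlindTwistSide

open NumberField IsDedekindDomain Field WeierstrassCurve Literature.NumberTheory.EllipticCurves
  Literature.NumberTheory.GaloisRepresentations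
open Summit.BirchSwinnertonDyer.Rank1Residual.Additive Summit.BirchSwinnertonDyer.Rank1Residual

universe u

/-- **HT-C2 = h4 (EXACT STRICT COUNT in rank one, any prime `p`).** For an elliptic curve `W/ℚ` with
`rank_ℤ W(ℚ) = 1` (and `Ш(W)[p^∞]` finite — idle for the equality), a NORMALISED functional
`λ : W(ℚ_p) →+ ℤ_p` (surjective, kernel = the torsion; exists by Silverman AEC VII.6.3) and a generator `P₁`
of `W(ℚ)` modulo torsion: the `p`-STRICT Selmer group
`Sel_{p^∞}(W/ℚ) ∩ ker (H¹(ℚ, W[p^∞]) → H¹(ℚ_p, W(ℚ̄_p)[p^∞]))` (`selmerGroupPInfty ⊓ selmerLocalKerPrimaryTorsion`)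
has EXACTLY `#Ш(W)[p^∞] · p^{v_p(λ(P₁))}` elements (`Nat.card`; `0 = 0` if `Ш[p^∞]` is infinite).
Proof: `Sel_{p^∞} ⊇ im κ ≅ ℚ_p/ℤ_p` with `Sel/im κ ≅ Ш[p^∞]`; the strict classes surject onto `Ш[p^∞]`
and the strict Kummer classes are `{κ_ñ(a·P₁)} ≅ ℤ/p^ñ` with `ñ` the level of `P₁` in `W(ℚ_p)` modulo
torsion (`X12.O11.card_strictSelmer_eq_pow_mul_card_sha_modTorsion`), and `ñ = v_p(λ(P₁))` for a surjective
`λ` (`StrictCount.modTorsion_level_of_surjective`); the Selmer condition at `p` is transported from `ℚ_v` to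
`ℚ_[p]` by `StrictSha.selmerGroupPInfty_le_selmerLocalKerPrimary_padic`. The type is hand h4 of LEAD ss-1
GEN 20 (`HAND-TARGETS-CDC.md` §2) verbatim. [cite: GreenbergLNM1716, §2 pp. 62–63]
[cite: KuriharaPollack2007, §1.5 (p. 361)] [cite: Skinner2020, §2.2 (Lemma rank1lemma)]
[cite: SilvermanAEC2009, Prop. VII.6.3 and Thm. VIII.6.7] -/
theorem HTC2_natCard_strictSelmer_eq (W : WeierstrassCurve ℚ) [W.IsElliptic] (p : ℕ) [Fact p.Prime]
    (hrank : W.mordellWeilRank = 1) [Finite (AddCommGroup.primaryComponent W.sha p)]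
    (lam : (W.baseChange ℚ_[p]).toAffine.Point →+ ℤ_[p]) (hlam : ∀ X, lam X = 0 ↔ IsOfFinAddOrder X)
    (hsurj : Function.Surjective lam)
    (P₁ : W.toAffine.Point)
    (hgen : ∀ P : W.toAffine.Point, ∃ (a : ℤ) (t : W.toAffine.Point), IsOfFinAddOrder t ∧ P = a • P₁ + t) :
    Nat.card ↥(W.selmerGroupPInfty p ⊓ selmerLocalKerPrimaryTorsion W ℚ_[p] p) =
      Nat.card (AddCommGroup.primaryComponent W.sha p) *
        p ^ (lam (Affine.Point.baseChange (W' := W) ℚ ℚ_[p] P₁)).valuation := by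
  have _hfin : Finite (AddCommGroup.primaryComponent W.sha p) := inferInstance
  -- `P₁` has infinite order: a rank-one generator `P'` of infinite order is `a • P₁ + t`, `t` torsion
  obtain ⟨P', hP', -⟩ := exists_generator_of_mordellWeilRank_eq_one W hrank
  have hP₁ : ¬ IsOfFinAddOrder P₁ := by
    intro h
    obtain ⟨a, t, ht, hP't⟩ := hgen P'
    have h' : IsOfFinAddOrder P' := by
      rw [hP't]
      exact (h.zsmul).add ht
    exact hP' (by convert h')
  -- `λ(bc P₁) ≠ 0`: base change of points is injective and `λ` vanishes exactly on the torsion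
  let bc : W.toAffine.Point →+ (W.baseChange ℚ_[p]).toAffine.Point :=
    Affine.Point.baseChange (W' := W) ℚ ℚ_[p]
  have hinj : Function.Injective bc := Affine.Point.map_injective (W' := W) (Algebra.ofId ℚ ℚ_[p])
  have hu0 : lam (bc P₁) ≠ 0 := by
    intro h0
    apply hP₁
    obtain ⟨n, hn, hnP⟩ := isOfFinAddOrder_iff_nsmul_eq_zero.mp ((hlam _).mp h0)
    refine isOfFinAddOrder_iff_nsmul_eq_zero.mpr ⟨n, hn, hinj ?_⟩
    rw [map_nsmul, map_zero]
    exact hnP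
  -- `im λ ⊇ p^0 ℤ_p`
  have hlamb : ∀ z : ℤ_[p], ∃ Y, lam Y = (p : ℤ_[p]) ^ 0 * z := fun z => by
    obtain ⟨Y, hY⟩ := hsurj z
    exact ⟨Y, by rw [pow_zero, one_mul]; exact hY⟩
  -- the exact mod-torsion level of `bc P₁` is `v(λ(bc P₁))`
  obtain ⟨hdivP, hndiv⟩ := StrictCount.modTorsion_level_of_surjective p lam hlam hsurj hu0
  -- Greenberg's snake, torsion-modded (X12.O11), with the transported local condition at `ℚ_[p]`
  have hcount := X12.O11.card_strictSelmer_eq_pow_mul_card_sha_modTorsion W p ℚ_[p] lam hlam hlamb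
    (StrictSha.selmerGroupPInfty_le_selmerLocalKerPrimary_padic W p) (P := P₁)
    (n := (lam (bc P₁)).valuation) (by convert hP₁)
    (fun R => by
      obtain ⟨k, T, hT, hR⟩ := hgen R
      exact ⟨k, T, by convert hT, by convert hR⟩)
    hdivP hndiv
  rw [mul_comm]
  exact hcount

end Summit.BirchSwinnertonDyer.BirchSwinnertonDyer.Theorems.FlatBlindTwistSide

end
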